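import Summits.Ventures.PercRepro.C041BlockMapExitFamilies
import Summits.Ventures.PercRepro.C041BlockMapBlockTree
import Summits.Ventures.PercRepro.C041BlockMapFourCores

/-!
# ROW C-041 — EVERY FAMILY OF EXITS IS THE NON-ANCHOR VERTICES ONCE; THE TRIANGLE'S OPEN CORE IS ITS EVERY-FAMILY
STATEMENT; TRIANGLE CACTI (p6, gen 37)

With THEOREM (EXIT FAMILIES) (`C041BlockMapExitFamilies`) and THEOREM (ANCHOR EXIT): a host is a cone host for every
family of exits iff it is one with the NON-ANCHOR vertices as exits, once (`coneHostAll_iff_nonanchor`).  For the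
triangle this is the open core itself: `coneHostAll_tri_iff : ConeHostAll tri 0 ↔ ConeHost tri triExit 0` — CONJECTURE
(BLOCK MAP) for the triangle at EVERY family of exits (any multiplicities, the anchor included) is equivalent to its
two-exit form.  With THEOREM (BLOCK TREES): every host grown from its anchor by hanging triangles (at any vertex, with
any of their vertices as the attachment), edges and isolated vertices — the TRIANGLE CACTI — is a cone host for every
family of exits as soon as the triangle is (`blockGrown_hang_tri`, `coneHostAll_of_triangleGrown`).  For the cores
`k4`, `d1`, `d2`: their every-family statements are their three-exit forms (`coneHostAll_k4_iff` …), stronger than the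
two-exit forms of `C041BlockMapCoresPure`.
-/

namespace PercRepro

namespace ZoneZ

namespace MultiExit

open ZoneData Pendant Finset TwoExit TreeClosure

/-! ## The non-anchor vertices, once -/

section NonAnchor

variable {V₁ E₁ U₁ U₂ : Type} (Z₁ : ZoneData V₁ E₁ U₁ U₂) (a₁ : V₁) [Fintype V₁] [DecidableEq V₁] [Fintype E₁]
  [DecidableEq E₁]

/-- The non-anchor vertices, as a family of exits. -/
def nonAnchor : {v : V₁ // v ≠ a₁} → V₁ := Subtype.val

omit [Fintype V₁] in
/-- Every vertex is the anchor or a non-anchor vertex: the identity factors through `uplus nonAnchor a₁`. -/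
theorem id_factor (v : V₁) :
    v = uplus (nonAnchor a₁) a₁ (if h : v = a₁ then none else some ⟨v, h⟩) := by
  split_ifs with h
  · exact h
  · rfl

/-- **A host is a cone host for every family of exits iff it is one with the non-anchor vertices as exits, once.** -/
theorem coneHostAll_iff_nonanchor : ConeHostAll Z₁ a₁ ↔ ConeHost Z₁ (nonAnchor a₁) a₁ := by
  constructor
  · intro h
    exact h _
  · intro h
    rw [coneHostAll_iff_id]
    exact coneHost_of_factor Z₁ (uplus (nonAnchor a₁) a₁) a₁ (fun v => if h : v = a₁ then none else some ⟨v, h⟩) id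
      (fun v => id_factor a₁ v) (coneHost_uplus_anchor Z₁ (nonAnchor a₁) a₁ h)

end NonAnchor

/-! ## The triangle: the open core is the every-family statement -/

/-- The non-anchor vertices of the triangle are its exits, re-indexed. -/
theorem nonAnchor_tri : nonAnchor (0 : Fin 3) =
    triExit ∘ fun v : {v : Fin 3 // v ≠ 0} => if v.1 = 1 then Sum.inl () else Sum.inr () := by
  funext v
  obtain ⟨v, hv⟩ := v
  fin_cases v
  · exact absurd rfl hv
  · rfl
  · rfl

/-- The exits of the triangle factor through the non-anchor vertices. -/
theorem triExit_factor : triExit = nonAnchor (0 : Fin 3) ∘ fun k => match k with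
    | Sum.inl _ => ⟨1, by decide⟩
    | Sum.inr _ => ⟨2, by decide⟩ := by
  funext k
  rcases k with ⟨⟩ | ⟨⟩ <;> rfl

/-- **CONJECTURE (BLOCK MAP) for the triangle at every family of exits is its two-exit form** — the open core of the
row is the strongest triangle statement. -/
theorem coneHostAll_tri_iff : ConeHostAll tri 0 ↔ ConeHost tri triExit 0 := by
  rw [coneHostAll_iff_nonanchor]
  constructor
  · intro h
    rw [triExit_factor]
    exact coneHost_comp tri _ 0 _ h
  · intro h
    rw [nonAnchor_tri]
    exact coneHost_comp tri _ 0 _ h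

/-- The triangle is a cone host for every family of exits as soon as it is one at its two exits. -/
theorem coneHostAll_tri_of (h : ConeHost tri triExit 0) : ConeHostAll tri 0 :=
  coneHostAll_tri_iff.2 h

/-! ## Triangle cacti -/

/-- Hanging a triangle at any vertex of a block-grown host keeps it block-grown, given the open core. -/
theorem blockGrown_hang_tri (htri : ConeHost tri triExit 0) {V E U₁ U₂ : Type} [Fintype E] [DecidableEq E]
    {Z : ZoneData V E U₁ U₂} {a : V} (h : BlockGrown Z a) (x : V) : BlockGrown (hangAt Z tri x 0) (Sum.inl a) :=
  BlockGrown.hang Z a x tri 0 (coneHostAll_tri_of htri) h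

/-- THE TRIANGLE CACTI: grown from the point by hanging triangles (at any vertex) and edges, by isolated vertices,
up to isomorphism. -/
inductive TriangleGrown : ∀ {V E U₁ U₂ : Type} [Fintype E] [DecidableEq E], ZoneData V E U₁ U₂ → V → Prop
  /-- the point -/
  | point : TriangleGrown pointHost ()
  /-- a triangle hung at `x` -/
  | tri {V E U₁ U₂ : Type} [Fintype E] [DecidableEq E] (Z : ZoneData V E U₁ U₂) (a x : V)
      (h : TriangleGrown Z a) : TriangleGrown (hangAt Z tri x 0) (Sum.inl a)
  /-- an edge hung at `x` -/
  | edge {V E U₁ U₂ : Type} [Fintype E] [DecidableEq E] (Z : ZoneData V E U₁ U₂) (a x : V)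
      (h : TriangleGrown Z a) : TriangleGrown (hangAt Z edgeHost x false) (Sum.inl a)
  /-- an isolated vertex -/
  | isolated {V E U₁ U₂ : Type} [Fintype E] [DecidableEq E] (Z : ZoneData V E U₁ U₂) (a : V)
      (h : TriangleGrown Z a) : TriangleGrown (addIsolated Z) (some a)
  /-- an isomorphic host -/
  | iso {V₁ E₁ U₁ W₁ V₂ E₂ U₂ W₂ : Type} [Fintype E₁] [DecidableEq E₁] [Fintype E₂] [DecidableEq E₂]
      (Z₁ : ZoneData V₁ E₁ U₁ W₁) (Z₂ : ZoneData V₂ E₂ U₂ W₂) (fv : V₁ ≃ V₂) (fe : E₁ ≃ E₂)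
      (hJ : ∀ e x y, Z₂.Joins (fe e) (fv x) (fv y) ↔ Z₁.Joins e x y) (a : V₁) (h : TriangleGrown Z₁ a) :
      TriangleGrown Z₂ (fv a)

/-- Every triangle cactus is block-grown, given the open core. -/
theorem blockGrown_of_triangleGrown (htri : ConeHost tri triExit 0) {V E U₁ U₂ : Type} [Fintype E] [DecidableEq E]
    {Z : ZoneData V E U₁ U₂} {a : V} (h : TriangleGrown Z a) : BlockGrown Z a := by
  induction h with
  | point => exact BlockGrown.point
  | tri Z a x _ ih => exact blockGrown_hang_tri htri ih x
  | edge Z a x _ ih => exact blockGrown_hang_edge ih x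
  | isolated Z a _ ih => exact BlockGrown.isolated Z a ih
  | iso Z₁ Z₂ fv fe hJ a _ ih => exact BlockGrown.iso Z₁ Z₂ fv fe hJ a ih

/-- **THEOREM (TRIANGLE CACTI)**: every host grown from its anchor by hanging triangles and edges is a cone host for
every family of exits as soon as the triangle is. -/
theorem coneHostAll_of_triangleGrown (htri : ConeHost tri triExit 0) {V E U₁ U₂ : Type} [Fintype E]
    [DecidableEq E] {Z : ZoneData V E U₁ U₂} {a : V} (h : TriangleGrown Z a) : ConeHostAll Z a :=
  coneHostAll_of_blockGrown (blockGrown_of_triangleGrown htri h)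

/-! ## The cores: the every-family statements are the three-exit forms -/

/-- The non-anchor vertices of a host on `Fin 4` with the anchor `0` are `1`, `2`, `3`, re-indexed. -/
theorem nonAnchor_fin4 : nonAnchor (0 : Fin 4) = Fin.succ ∘ fun v : {v : Fin 4 // v ≠ 0} => v.1.pred v.2 := by
  funext v
  obtain ⟨v, hv⟩ := v
  exact (Fin.succ_pred v hv).symm

/-- The three non-anchor vertices factor through the non-anchor family. -/
theorem fin_succ_factor : (Fin.succ : Fin 3 → Fin 4) = nonAnchor (0 : Fin 4) ∘ fun i => ⟨i.succ, Fin.succ_ne_zero i⟩ := by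
  funext i
  rfl

/-- A host on `Fin 4` with the anchor `0` is a cone host for every family of exits iff it is one with the exits `1`,
`2`, `3`. -/
theorem coneHostAll_fin4_iff {E : Type} [Fintype E] [DecidableEq E] (Z : ZoneData (Fin 4) E Empty Empty) :
    ConeHostAll Z 0 ↔ ConeHost Z (Fin.succ : Fin 3 → Fin 4) 0 := by
  rw [coneHostAll_iff_nonanchor]
  constructor
  · intro h
    rw [fin_succ_factor]
    exact coneHost_comp Z _ 0 _ h
  · intro h
    rw [nonAnchor_fin4]
    exact coneHost_comp Z _ 0 _ h

/-- **`K₄` for every family of exits is `K₄` with the three exits `1`, `2`, `3`.** -/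
theorem coneHostAll_k4_iff : ConeHostAll k4 0 ↔ ConeHost k4 (Fin.succ : Fin 3 → Fin 4) 0 :=
  coneHostAll_fin4_iff k4

/-- **`K₄ − uu′` for every family of exits is its three-exit form.** -/
theorem coneHostAll_d1_iff : ConeHostAll d1 0 ↔ ConeHost d1 (Fin.succ : Fin 3 → Fin 4) 0 :=
  coneHostAll_fin4_iff d1

/-- **`K₄ − au` for every family of exits is its three-exit form.** -/
theorem coneHostAll_d2_iff : ConeHostAll d2 0 ↔ ConeHost d2 (Fin.succ : Fin 3 → Fin 4) 0 :=
  coneHostAll_fin4_iff d2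

/-- The three-exit form of a core implies its two-exit form. -/
theorem coneHost_ex2_of_succ {E : Type} [Fintype E] [DecidableEq E] (Z : ZoneData (Fin 4) E Empty Empty)
    (h : ConeHost Z (Fin.succ : Fin 3 → Fin 4) 0) : ConeHost Z (ex2 1 2) 0 :=
  coneHost_of_factor Z _ 0 (fun b : Bool => if b then 1 else 0) (ex2 1 2) (fun b => by cases b <;> rfl) h

end MultiExit

end ZoneZ

end PercRepro
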